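import Literature.NumberTheory.EllipticCurves.CyclicPrimeDegreeRank
import Literature.NumberTheory.EllipticCurves.TwoDescent
import Mathlib.RingTheory.Finiteness.Nakayama
import HarnessLib

/-!
# `2`-descent in a Galois extension of odd degree: only the norm kernel matters

For a Galois extension of number fields `F/K` of ODD degree and an elliptic curve `E/K` with
rational `2`-torsion, the Mordell–Weil rank does not grow in `F`, `rank_ℤ E(F) = rank_ℤ E(K)`,
as soon as the complete `2`-descent map `δ : E(F) → Fˣ/Fˣ² × Fˣ/Fˣ²` (Silverman, *AEC*,
Prop. X.1.4; tree file `TwoDescent.lean`) is trivial on the **norm kernel**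
`B = {P ∈ E(F) : ∑_{σ ∈ Gal(F/K)} σP = O}` — equivalently, as soon as the only classes of
norm `1` in the image of `E(F)` are trivial. Three forms are proved:

* `WeierstrassCurve.mordellWeilRank_baseChange_eq_of_odd_of_twoDescent_normKer`:
  `δ(B) = 1 ⟹ rank E(F) = rank E(K)`;
* `WeierstrassCurve.mordellWeilRank_baseChange_eq_of_odd_of_twoDescent_rational`: if every
  `δ(P)`, `P ∈ E(F)`, is a pair of `K`-RATIONAL classes (e.g. `Sel₂(E/F) = res Sel₂(E/K)`),
  then `rank E(F) = rank E(K)` (`δ` is `Gal(F/K)`-equivariant, so for `P ∈ B`,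
  `1 = δ(∑ σP) = δ(P)^{[F:K]} = δ(P)`);
* `WeierstrassCurve.mordellWeilRank_baseChange_eq_of_odd_of_twoDescent_norm`, the diophantine
  form a descent computation discharges: if for every `(x, y) ∈ E(F)` off the `2`-torsion with
  `N_{F/K}(x - e₁)` and `N_{F/K}(x - e₂)` squares in `K` the elements `x - e₁, x - e₂` are
  squares in `F`, then `rank E(F) = rank E(K)` (for `P ∈ B`, `δⱼ(P)` has norm
  `δⱼ(∑ σP) = 1`, and a norm which is a square in `F` is a square in `K` by odd degree).

The algebra (`Literature.NumberTheory.EllipticCurves.finrank_eq_finrank_invariants_of_norm_ker`):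
for a group `G` of odd order `n` acting on a finitely generated abelian group `M` with invariants
`A` and norm `N = ∑ g`, `rank M = rank A + rank B` with `B = ker N` (the tree's
`rank_eq_add_of_isCompl_up_to_torsion`: `A ∩ B` is `n`-torsion, `nM ⊆ A + B`), and if `B ⊆ 2M`
then `B = 2B` (`b = 2q ∈ B ⟹ q' = nq - Nq ∈ B`, `2q' = nb`, `n` odd), so an odd integer kills
`B` (Nakayama) and `rank B = 0`. For the curve, `G = Gal(F/K)` acts on `E(F)` by transport of
coordinates with invariants `E(K)` exactly as in `CyclicPrimeDegreeRank.lean`, `E(F)` is finitely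
generated by the tree's Mordell–Weil theorem `WeierstrassCurve.module_finite_point_holds`, and
`ker δ = 2E(F)` is `ker_twoDescentMap` / `exists_add_self_of_twoDescentComponent_eq_one`.

Motivation: the proof of Theorem 2 of T. Dokchitser–V. Dokchitser, *A note on the Mordell–Weil
rank modulo `n`*, J. Number Theory 131 (2011) 1833–1839 (arXiv:0910.4588) computes
`rk E(F₃) = rk E(F₅) = 1` for `E = 480a1` "by 2-descent […] over all minimal non-trivial
subfields of `F_n`", i.e. over cyclic cubic (quintic) subfields `K_σ`; with `rk E(ℚ) = 1` proved
in the tree (`Literature/Barriers/BirchSwinnertonDyer/RankNotSumOfLocalInvariants480a1RankProofs.lean`),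
what such a descent over `K_σ` must deliver is precisely the hypothesis of the `norm` form above:
the norm-`1` part of the `2`-Selmer image of `E(K_σ)` is trivial. The prime-degree Artin
formalism `rank E(K_σ) = rank E(ℚ) + (ℓ - 1)d` is `CyclicPrimeDegreeRank.lean`; here no
primality is needed.

## Contents (all proved; no definitions, no named facts)

* algebra: `finrank_eq_finrank_invariants_of_norm_ker`,
  `isSquare_of_isSquare_algebraMap_of_odd_finrank` (a square in an odd-degree extension is a square);
* `2`-descent API supplements (deliberate dot-notation extensions of Mathlib's
  `WeierstrassCurve.Affine(.Point)` namespaces, next to the tree's `twoDescentComponent` and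
  `sqClass`): `twoDescentComponent_sum_of_forall_eq`, `twoDescentComponent_sum`, `sqClass_prod`,
  `WeierstrassCurve.twoDescentComponent_map_of_eq_sqClass_algebraMap` (equivariance on rational
  classes), `WeierstrassCurve.sum_map_ne_zero_of_X_eq_algebraMap` (rational `2`-torsion points
  are not in the norm kernel);
* the three rank theorems above.

## Design notes

`noncomputable section`, `open scoped Classical` and no `[DecidableEq]` variables, as in
`TwoDescentRankBounds.lean` / `CyclicPrimeDegreeRank.lean`, so that the group law on points and
the descent map are elaborated against the classical instances carried by
`WeierstrassCurve.mordellWeilRank`. Hypotheses on the descent map are phrased through the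
components `twoDescentComponent` (total functions) rather than `twoDescentMap`, which needs the
`IsElliptic` instance of the base-changed curve in the statement. `K F : Type` (universe `0`),
matching the barrier files that consume the theorems.

## References

* J. H. Silverman, *The Arithmetic of Elliptic Curves*, 2nd ed., GTM 106 (2009), Prop. X.1.4
  (complete `2`-descent), Thm. X.1.1 and Ex. 10.1; Thm. VIII.6.7 (Mordell–Weil).
  [SilvermanAEC2009]
* T. Dokchitser, V. Dokchitser, *A note on the Mordell–Weil rank modulo `n`*, J. Number Theory
  131 (2011) 1833–1839, arXiv:0910.4588: proof of Thm. 2. [DokchitserDokchitser2011RankModN]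
-/

noncomputable section

open scoped Classical

open Module

namespace Literature.NumberTheory.EllipticCurves

/-! ### Algebra: an odd-order group action whose norm kernel is `2`-divisible -/

/-- **Rank equals rank of invariants when the norm kernel is `2`-divisible.**
Let a finite group `G` of odd order act on a finitely generated abelian group `M`
(`ρ : G →* End_ℤ M`) with invariants `A`, and let `N = ∑_g ρ g` be the norm. If every element
of the norm kernel `B = ker N` is a double in `M` (`N m = 0 → m ∈ 2M`; e.g. because a complete
`2`-descent map, whose kernel is `2M`, vanishes on `B`), then `rank_ℤ M = rank_ℤ A`. Proof:
`rank M = rank A + rank B` (`A ∩ B` is `|G|`-torsion and `|G|·M ⊆ A + B`, as `N² = |G|·N`;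
`rank_eq_add_of_isCompl_up_to_torsion`), and `B = 2B`: for `b = 2q ∈ B` the element
`q' = |G|·q - N q` lies in `B` with `2q' = |G|·b`, and `|G|` is odd; so by Nakayama some odd
integer kills the finitely generated group `B`, which is therefore torsion, `rank B = 0`.
[folklore] -/
theorem finrank_eq_finrank_invariants_of_norm_ker {M : Type*} [AddCommGroup M]
    [Module.Finite ℤ M] {G : Type*} [Group G] [Fintype G] (ρ : G →* Module.End ℤ M)
    (hodd : Odd (Fintype.card G)) (A : Submodule ℤ M) (hA : ∀ a ∈ A, ∀ g : G, ρ g a = a)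
    (hA' : ∀ m : M, (∀ g : G, ρ g m = m) → m ∈ A)
    (hdiv : ∀ m : M, ∑ g, ρ g m = 0 → ∃ m' : M, m = 2 • m') :
    Module.finrank ℤ M = Module.finrank ℤ A := by
  haveI : IsNoetherian ℤ M := isNoetherian_of_isNoetherianRing_of_finite ℤ M
  obtain ⟨k, hk⟩ := hodd
  set n : ℕ := Fintype.card G with hn
  -- the norm `N = ∑ g, ρ g` and its kernel `B`
  set N : Module.End ℤ M := ∑ g, ρ g with hN
  have hgN : ∀ g : G, ρ g * N = N := fun g => by
    rw [hN, Finset.mul_sum]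
    simp_rw [← map_mul]
    exact Fintype.sum_equiv (Equiv.mulLeft g) _ _ fun h => rfl
  have hNA : ∀ m, N m ∈ A := fun m => hA' _ fun g => by
    rw [← Module.End.mul_apply, hgN]
  have hAN : ∀ a ∈ A, N a = (n : ℤ) • a := fun a ha => by
    rw [hN, LinearMap.sum_apply, Finset.sum_congr rfl fun g _ => hA a ha g, Finset.sum_const,
      Finset.card_univ, hn, natCast_zsmul]
  have hNN : N * N = (n : ℤ) • N := by
    ext m
    rw [Module.End.mul_apply, hAN _ (hNA m), LinearMap.smul_apply]
  set B : Submodule ℤ M := LinearMap.ker N with hBdef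
  -- `A ⊓ B` is killed by `n` and `n M ⊆ A + B`, so `rank M = rank A + rank B`
  have hnk : (n : ℤ) = 2 * k + 1 := by rw [hk]; push_cast; ring
  have hn0 : (n : ℤ) ≠ 0 := by rw [hnk]; omega
  have hinf : ∀ x ∈ A ⊓ B, (n : ℤ) • x = 0 := fun x hx => by
    rw [← hAN x hx.1]
    exact hx.2
  have hsup : ∀ m : M, (n : ℤ) • m ∈ A ⊔ B := fun m => by
    have e : (n : ℤ) • m = N m + ((n : ℤ) • m - N m) := by abel
    rw [e]
    refine Submodule.add_mem_sup (hNA m) ?_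
    rw [hBdef, LinearMap.mem_ker, map_sub, LinearMap.map_smul_of_tower, ← Module.End.mul_apply,
      hNN, LinearMap.smul_apply, sub_self]
  have hrank := rank_eq_add_of_isCompl_up_to_torsion A B hn0 hinf hsup
  -- `B = 2B`: for `b = 2q ∈ B`, `q' = n q - N q ∈ B` has `2 q' = n b`, and `n` is odd
  have hB2 : ∀ b ∈ B, ∃ b' ∈ B, b = (2 : ℤ) • b' := by
    intro b hb
    have hb0 : N b = 0 := LinearMap.mem_ker.mp hb
    obtain ⟨q, hq⟩ := hdiv b (by rw [← LinearMap.sum_apply]; exact hb0)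
    have hq2 : b = (2 : ℤ) • q := by rw [hq, ofNat_zsmul]
    have hR : N q ∈ A := hNA q
    set q' : M := (n : ℤ) • q - N q with hq'
    have hq'B : q' ∈ B := by
      rw [hBdef, LinearMap.mem_ker, hq', map_sub, LinearMap.map_smul_of_tower, hAN _ hR, sub_self]
    have h2q' : (2 : ℤ) • q' = (n : ℤ) • b := by
      rw [hq', smul_sub, smul_comm, ← hq2, ← LinearMap.map_smul_of_tower, ← hq2, hb0, sub_zero]
    refine ⟨q' - (k : ℤ) • b, B.sub_mem hq'B (B.smul_mem _ hb), ?_⟩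
    have h1 : (n : ℤ) - 2 * k = 1 := by rw [hnk]; ring
    rw [smul_sub, h2q', smul_smul, ← sub_smul, h1, one_smul]
  -- Nakayama: an integer `r ≡ 1 (mod 2)` kills `B`, so `rank B = 0`
  have hBfg : B.FG := IsNoetherian.noetherian B
  have hle : B ≤ Ideal.span {(2 : ℤ)} • B := fun b hb => by
    obtain ⟨b', hb', rfl⟩ := hB2 b hb
    exact Submodule.smul_mem_smul (Ideal.mem_span_singleton_self 2) hb'
  obtain ⟨r, hr1, hr⟩ :=
    Submodule.exists_sub_one_mem_and_smul_eq_zero_of_fg_of_le_smul (Ideal.span {(2 : ℤ)}) B hBfg hle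
  have hr0 : r ≠ 0 := by
    rintro rfl
    rw [zero_sub, Ideal.mem_span_singleton] at hr1
    omega
  have hrankB : Module.rank ℤ B = 0 :=
    rank_eq_zero_of_smul_eq_zero (N := B) (mem_nonZeroDivisors_of_ne_zero hr0)
      fun x => Subtype.ext (hr x x.2)
  rw [hrankB, add_zero] at hrank
  have key : ((Module.finrank ℤ M : ℕ) : Cardinal) = ((Module.finrank ℤ A : ℕ) : Cardinal) := by
    rw [Module.finrank_eq_rank, Module.finrank_eq_rank]
    exact hrank
  exact_mod_cast key

end Literature.NumberTheory.EllipticCurves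

/-! ### The `2`-descent component of a sum of points with equal components -/

namespace WeierstrassCurve.Affine.Point

variable {F : Type*} [Field F] [CharZero F] {W : Affine F} [W.IsElliptic] {e₁ e₂ e₃ : F}

/-- The `2`-descent component of a sum of points all having the same component `c` is `1` or
`c` according to the parity of the number of summands (`δ` is a homomorphism into a group of
exponent `2`, `twoDescentComponent_add`, `SqUnits.mul_self`). A deliberate dot-notation
extension of Mathlib's `WeierstrassCurve.Affine.Point` namespace, next to the tree's
`twoDescentComponent`. [folklore] -/
theorem twoDescentComponent_sum_of_forall_eq (h : W.SplitTwoTorsion e₁ e₂ e₃) {ι : Type*}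
    (s : Finset ι) (g : ι → W.Point) (c : SqUnits F)
    (hc : ∀ i ∈ s, twoDescentComponent W e₁ e₂ e₃ (g i) = c) :
    twoDescentComponent W e₁ e₂ e₃ (∑ i ∈ s, g i) = if Even s.card then 1 else c := by
  induction s using Finset.induction_on with
  | empty => rw [Finset.sum_empty, twoDescentComponent_zero, Finset.card_empty, if_pos (show Even 0 from ⟨0, rfl⟩)]
  | insert a s ha ih =>
    rw [Finset.sum_insert ha, twoDescentComponent_add h, hc a (Finset.mem_insert_self a s),
      ih fun i hi => hc i (Finset.mem_insert_of_mem hi), Finset.card_insert_of_notMem ha]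
    by_cases hs : Even s.card
    · have hs' : ¬ Even (s.card + 1) := fun h' => by
        rw [Nat.even_add_one] at h'
        exact h' hs
      rw [if_pos hs, if_neg hs', SqUnits.mul_one]
    · have hs' : Even (s.card + 1) := by rwa [Nat.even_add_one]
      rw [if_neg hs, if_pos hs', SqUnits.mul_self]

/-- **The `2`-descent component of a sum is the product of the components** (`δ` is a
homomorphism, `twoDescentComponent_add`), `Finset` form. A deliberate dot-notation extension of
Mathlib's `WeierstrassCurve.Affine.Point` namespace. [folklore] -/
theorem twoDescentComponent_sum (h : W.SplitTwoTorsion e₁ e₂ e₃) {ι : Type*} (s : Finset ι)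
    (g : ι → W.Point) :
    twoDescentComponent W e₁ e₂ e₃ (∑ i ∈ s, g i) =
      ∏ i ∈ s, twoDescentComponent W e₁ e₂ e₃ (g i) := by
  induction s using Finset.induction_on with
  | empty => rw [Finset.sum_empty, twoDescentComponent_zero, Finset.prod_empty]
  | insert a s ha ih =>
    rw [Finset.sum_insert ha, twoDescentComponent_add h, ih, Finset.prod_insert ha]

end WeierstrassCurve.Affine.Point

namespace WeierstrassCurve.Affine

/-- **Square classes are multiplicative**, `Finset` form: the class of a product of non-zero
elements is the product of the classes (`sqClass_mul`). A deliberate dot-notation extension of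
Mathlib's `WeierstrassCurve.Affine` namespace, next to the tree's `sqClass`. [folklore] -/
theorem sqClass_prod {F : Type*} [Field F] {ι : Type*} (s : Finset ι) (f : ι → F)
    (hf : ∀ i ∈ s, f i ≠ 0) : sqClass (∏ i ∈ s, f i) = ∏ i ∈ s, sqClass (f i) := by
  induction s using Finset.induction_on with
  | empty =>
    rw [Finset.prod_empty, Finset.prod_empty]
    have h1 := sqClass_sq (1 : F)
    rwa [one_pow] at h1
  | insert a s ha ih =>
    have hs : ∀ i ∈ s, f i ≠ 0 := fun i hi => hf i (Finset.mem_insert_of_mem hi)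
    rw [Finset.prod_insert ha, Finset.prod_insert ha,
      sqClass_mul (hf a (Finset.mem_insert_self a s)) (Finset.prod_ne_zero_iff.mpr hs), ih hs]

end WeierstrassCurve.Affine

namespace Literature.NumberTheory.EllipticCurves

/-- **An element of `K` which becomes a square in an extension of odd degree is a square in
`K`**: if `q = w²` in `F` with `[F:K] = 2k + 1`, then taking norms `q^{2k+1} = N(w)²`, so
`q = (N(w)/q^k)²` (`Algebra.norm_algebraMap`). [folklore] -/
theorem isSquare_of_isSquare_algebraMap_of_odd_finrank {K F : Type*} [Field K] [Field F] [Algebra K F]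
    [FiniteDimensional K F] (hodd : Odd (Module.finrank K F)) {q : K}
    (h : IsSquare (algebraMap K F q)) : IsSquare q := by
  by_cases hq : q = 0
  · exact ⟨0, by rw [hq, mul_zero]⟩
  obtain ⟨w, hw⟩ := h
  obtain ⟨k, hk⟩ := hodd
  have key : q ^ (2 * k + 1) = Algebra.norm K w * Algebra.norm K w := by
    rw [← hk, ← Algebra.norm_algebraMap, hw, map_mul]
  refine ⟨Algebra.norm K w / q ^ k, ?_⟩
  rw [div_mul_div_comm, ← key, eq_div_iff (mul_ne_zero (pow_ne_zero k hq) (pow_ne_zero k hq))]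
  ring

end Literature.NumberTheory.EllipticCurves

/-! ### Elliptic curves: the rank in a Galois extension of odd degree -/

namespace WeierstrassCurve

open Literature.NumberTheory.EllipticCurves WeierstrassCurve.Affine WeierstrassCurve.Affine.Point

section Equivariance

variable {K : Type} [Field K] (W : WeierstrassCurve K) {F' : Type} [Field F'] [Algebra K F']

/-- **Equivariance of the `2`-descent components on rational classes.** For `E/K` with
rational `2`-torsion `e₁, e₂, e₃ ∈ K`, a `K`-algebra map `σ : F → F` and a point `P ∈ E(F)`
whose descent component `δ₁(P) ∈ Fˣ/Fˣ²` is the class of an element `r ∈ Kˣ`, the component of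
`σP` is the same class: `x(σP) - e₁ = σ(x(P) - e₁) = σ(r u²) = r σ(u)²`. A deliberate
dot-notation extension of Mathlib's `WeierstrassCurve` namespace. [folklore] -/
theorem twoDescentComponent_map_of_eq_sqClass_algebraMap (e₁ e₂ e₃ : K) (σ : F' →ₐ[K] F')
    (P : (W.baseChange F').toAffine.Point) {r : K} (hr : r ≠ 0)
    (h : twoDescentComponent (W.baseChange F').toAffine (algebraMap K F' e₁) (algebraMap K F' e₂)
      (algebraMap K F' e₃) P = sqClass (algebraMap K F' r)) :
    twoDescentComponent (W.baseChange F').toAffine (algebraMap K F' e₁) (algebraMap K F' e₂)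
      (algebraMap K F' e₃) (Point.map (W' := W.toAffine) σ P) = sqClass (algebraMap K F' r) := by
  rcases P with _ | ⟨x, y, hP⟩
  · exact h
  · rw [Point.map_some]
    by_cases hx : x = algebraMap K F' e₁
    · rw [twoDescentComponent_some_of_eq hP hx] at h
      rwa [twoDescentComponent_some_of_eq _ (by rw [hx, AlgHom.commutes])]
    · have hσx : σ x ≠ algebraMap K F' e₁ := fun h' =>
        hx (σ.injective (h'.trans (σ.commutes e₁).symm))
      rw [twoDescentComponent_some_of_ne hP hx] at h
      rw [twoDescentComponent_some_of_ne _ hσx]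
      have hx0 : x - algebraMap K F' e₁ ≠ 0 := sub_ne_zero.mpr hx
      have hr0 : algebraMap K F' r ≠ 0 := (map_ne_zero _).mpr hr
      -- `(x - e₁) r` is a square, `w²`
      have hsq : sqClass ((x - algebraMap K F' e₁) * algebraMap K F' r) = 1 := by
        rw [sqClass_mul hx0 hr0, h, SqUnits.mul_self]
      obtain ⟨w, hw⟩ := (sqClass_eq_one_iff (mul_ne_zero hx0 hr0)).mp hsq
      -- apply `σ`: `(σ x - e₁) r = (σ w)²`
      have hσ : (σ x - algebraMap K F' e₁) * algebraMap K F' r = σ w ^ 2 := by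
        have e := congrArg σ hw
        rw [map_mul, map_sub, AlgHom.commutes, AlgHom.commutes, map_pow] at e
        exact e
      have hσx0 : σ x - algebraMap K F' e₁ ≠ 0 := sub_ne_zero.mpr hσx
      have h1 : sqClass (σ x - algebraMap K F' e₁) * sqClass (algebraMap K F' r) = 1 := by
        rw [← sqClass_mul hσx0 hr0, hσ, sqClass_sq]
      calc sqClass (σ x - algebraMap K F' e₁)
          = sqClass (σ x - algebraMap K F' e₁) * 1 := (SqUnits.mul_one _).symm
        _ = sqClass (σ x - algebraMap K F' e₁) *
              (sqClass (algebraMap K F' r) * sqClass (algebraMap K F' r)) := by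
            rw [SqUnits.mul_self]
        _ = sqClass (σ x - algebraMap K F' e₁) * sqClass (algebraMap K F' r) *
              sqClass (algebraMap K F' r) := by rw [mul_assoc]
        _ = sqClass (algebraMap K F' r) := by rw [h1, SqUnits.one_mul]

end Equivariance

variable {K : Type} [Field K] [NumberField K] (W : WeierstrassCurve K) [W.IsElliptic]
  (F : Type) [Field F] [NumberField F] [Algebra K F] [IsGalois K F]

/-- **`rank E(F) = rank E(K)` when the `2`-descent map over `F` kills the norm kernel.**
Let `F/K` be a Galois extension of number fields of ODD degree, `E/K` an elliptic curve
(model `W`) whose `2`-torsion is rational over `F` (`e₁, e₂, e₃`), and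
`δ = (δ₁, δ₂) : E(F) → Fˣ/Fˣ² × Fˣ/Fˣ²` the complete `2`-descent map over `F`
(`twoDescentComponent`, kernel `2E(F)` by `ker_twoDescentMap`). If `δ(P) = (1, 1)` for every
`P ∈ E(F)` with `∑_{σ ∈ Gal(F/K)} σP = O` (the norm kernel), then `rank_ℤ E(F) = rank_ℤ E(K)`:
`Gal(F/K)` acts on the finitely generated group `E(F)` (Mordell–Weil, tree theorem
`WeierstrassCurve.module_finite_point_holds`) with invariants `E(K)` (Galois descent), and
`finrank_eq_finrank_invariants_of_norm_ker` applies. This is the algebra behind rank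
computations "by `2`-descent over the minimal non-trivial subfields" of an odd-degree abelian
extension: only the NEW part of the Selmer group over `F` (the classes of norm `1`) has to be
shown trivial. A deliberate dot-notation extension of Mathlib's `WeierstrassCurve` namespace.
[folklore] -/
theorem mordellWeilRank_baseChange_eq_of_odd_of_twoDescent_normKer
    (hodd : Odd (Module.finrank K F)) {e₁ e₂ e₃ : F}
    (he : (W.baseChange F).toAffine.SplitTwoTorsion e₁ e₂ e₃)
    (hB : ∀ P : (W.baseChange F).toAffine.Point,
      ∑ σ : F ≃ₐ[K] F, Point.map (W' := W.toAffine) (σ : F →ₐ[K] F) P = 0 →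
        twoDescentComponent (W.baseChange F).toAffine e₁ e₂ e₃ P = 1 ∧
          twoDescentComponent (W.baseChange F).toAffine e₂ e₁ e₃ P = 1) :
    (W.baseChange F).mordellWeilRank = (W.baseChange K).mordellWeilRank := by
  haveI : (W.baseChange F).IsElliptic := inferInstanceAs (W.map (algebraMap K F)).IsElliptic
  haveI : (W.baseChange K).IsElliptic := inferInstanceAs (W.map (algebraMap K K)).IsElliptic
  haveI : Module.Finite ℤ (W.baseChange F).toAffine.Point :=
    (W.baseChange F).module_finite_point_holds
  haveI : Module.Finite ℤ (W.baseChange K).toAffine.Point :=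
    (W.baseChange K).module_finite_point_holds
  haveI : FiniteDimensional K F := Module.finite_of_finrank_pos hodd.pos
  have hcard : Odd (Fintype.card (F ≃ₐ[K] F)) := by
    rwa [← Nat.card_eq_fintype_card, IsGalois.card_aut_eq_finrank]
  -- `Gal(F/K)` acts on `E(F)` by transport of coordinates
  let ρ : (F ≃ₐ[K] F) →* Module.End ℤ (W.baseChange F).toAffine.Point :=
    { toFun := fun σ => (Point.map (W' := W.toAffine) (σ : F →ₐ[K] F)).toIntLinearMap
      map_one' := by
        refine LinearMap.ext fun P => ?_
        rcases P with _ | ⟨x, y, h⟩ <;> rfl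
      map_mul' := fun σ τ => by
        refine LinearMap.ext fun P => ?_
        rcases P with _ | ⟨x, y, h⟩ <;> rfl }
  -- the invariants are `E(K)`
  set ι : (W.baseChange K).toAffine.Point →ₗ[ℤ] (W.baseChange F).toAffine.Point :=
    (Point.baseChange (W' := W.toAffine) K F).toIntLinearMap with hι
  have hιinj : Function.Injective ι := Point.map_injective (W' := W.toAffine) (Algebra.ofId K F)
  set A : Submodule ℤ (W.baseChange F).toAffine.Point := LinearMap.range ι with hAdef
  have hA : ∀ a ∈ A, ∀ σ : F ≃ₐ[K] F, ρ σ a = a := by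
    rintro _ ⟨P, rfl⟩ σ
    exact Point.map_baseChange (W' := W.toAffine) (σ : F →ₐ[K] F) P
  have hA' : ∀ m : (W.baseChange F).toAffine.Point, (∀ σ : F ≃ₐ[K] F, ρ σ m = m) → m ∈ A := by
    intro m hm
    rcases m with _ | ⟨x, y, h⟩
    · exact ⟨0, rfl⟩
    · have hfix : ∀ z : F, (∀ σ : F ≃ₐ[K] F, σ z = z) → z ∈ Set.range (algebraMap K F) :=
        fun z hz => (IsGalois.mem_range_algebraMap_iff_fixed z).mpr hz
      have hx : ∀ σ : F ≃ₐ[K] F, σ x = x := fun σ => by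
        have e := hm σ
        change Point.map (W' := W.toAffine) (σ : F →ₐ[K] F) (Point.some x y h) = _ at e
        rw [Point.map_some] at e
        exact (Point.some.inj e).1
      have hy : ∀ σ : F ≃ₐ[K] F, σ y = y := fun σ => by
        have e := hm σ
        change Point.map (W' := W.toAffine) (σ : F →ₐ[K] F) (Point.some x y h) = _ at e
        rw [Point.map_some] at e
        exact (Point.some.inj e).2
      obtain ⟨x₀, rfl⟩ := hfix x hx
      obtain ⟨y₀, rfl⟩ := hfix y hy
      have h₀ : (W.baseChange K).toAffine.Nonsingular x₀ y₀ :=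
        (baseChange_nonsingular (W := W.toAffine) (f := Algebra.ofId K F)
          (Algebra.ofId K F).injective x₀ y₀).mp h
      exact ⟨Point.some x₀ y₀ h₀, rfl⟩
  -- the norm kernel consists of doubles: `δ(P) = (1, 1)` means `P ∈ 2E(F)`
  have hdiv : ∀ P : (W.baseChange F).toAffine.Point, ∑ σ, ρ σ P = 0 →
      ∃ Q : (W.baseChange F).toAffine.Point, P = 2 • Q := by
    intro P hP
    obtain ⟨h₁, h₂⟩ := hB P hP
    obtain ⟨Q, hQ⟩ := exists_add_self_of_twoDescentComponent_eq_one he P h₁ h₂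
    exact ⟨Q, by rw [two_nsmul, hQ]⟩
  have key := finrank_eq_finrank_invariants_of_norm_ker ρ hcard A hA hA' hdiv
  have hAK : Module.finrank ℤ A = Module.finrank ℤ (W.baseChange K).toAffine.Point :=
    (LinearEquiv.ofInjective ι hιinj).finrank_eq.symm
  unfold mordellWeilRank
  rw [key, hAK]

/-- **`rank E(F) = rank E(K)` when the `2`-descent over `F` takes only `K`-rational values.**
Let `F/K` be Galois of odd degree, `E/K` an elliptic curve with rational `2`-torsion
`e₁, e₂, e₃ ∈ K`, and suppose that for every `P ∈ E(F)` both descent components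
`x(P) - e₁, x(P) - e₂ ∈ Fˣ/Fˣ²` are classes of elements of `Kˣ` — i.e. the image of `E(F)` in
the `2`-Selmer group over `F` consists of `K`-rational classes, as happens when `Sel₂(E/F)`
is the image of `Sel₂(E/K)`. Then `rank_ℤ E(F) = rank_ℤ E(K)`. Indeed for `P` in the norm
kernel, `∑_σ σP = O`, the class `c = δ₁(P)` satisfies `δ₁(σP) = c` for all `σ`
(`twoDescentComponent_map_of_eq_sqClass_algebraMap`), so `1 = δ₁(∑_σ σP) = c^{[F:K]} = c` as
`[F:K]` is odd and `c² = 1` (`twoDescentComponent_sum_of_forall_eq`); now apply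
`mordellWeilRank_baseChange_eq_of_odd_of_twoDescent_normKer`. For `[F:K] = ℓ` prime this is
how "2-descent over all minimal non-trivial subfields" (Dokchitser–Dokchitser 2011, proof of
Thm. 2) yields `rk E(K_σ) = rk E(ℚ)`. A deliberate dot-notation extension of Mathlib's
`WeierstrassCurve` namespace. [folklore] -/
theorem mordellWeilRank_baseChange_eq_of_odd_of_twoDescent_rational
    (hodd : Odd (Module.finrank K F)) (e₁ e₂ e₃ : K)
    (he : (W.baseChange F).toAffine.SplitTwoTorsion (algebraMap K F e₁) (algebraMap K F e₂)
      (algebraMap K F e₃))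
    (hrat : ∀ P : (W.baseChange F).toAffine.Point,
      (∃ r : K, r ≠ 0 ∧ twoDescentComponent (W.baseChange F).toAffine (algebraMap K F e₁)
        (algebraMap K F e₂) (algebraMap K F e₃) P = sqClass (algebraMap K F r)) ∧
      (∃ s : K, s ≠ 0 ∧ twoDescentComponent (W.baseChange F).toAffine (algebraMap K F e₂)
        (algebraMap K F e₁) (algebraMap K F e₃) P = sqClass (algebraMap K F s))) :
    (W.baseChange F).mordellWeilRank = (W.baseChange K).mordellWeilRank := by
  haveI : (W.baseChange F).IsElliptic := inferInstanceAs (W.map (algebraMap K F)).IsElliptic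
  haveI : FiniteDimensional K F := Module.finite_of_finrank_pos hodd.pos
  have hcard : Odd (Fintype.card (F ≃ₐ[K] F)) := by
    rwa [← Nat.card_eq_fintype_card, IsGalois.card_aut_eq_finrank]
  have hodd' : ¬ Even (Finset.univ : Finset (F ≃ₐ[K] F)).card := by
    rw [Finset.card_univ]
    exact Nat.not_even_iff_odd.mpr hcard
  refine W.mordellWeilRank_baseChange_eq_of_odd_of_twoDescent_normKer F hodd he fun P hP => ?_
  obtain ⟨⟨r, hr, h₁⟩, ⟨s, hs, h₂⟩⟩ := hrat P
  constructor
  · have key := twoDescentComponent_sum_of_forall_eq he Finset.univ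
      (fun σ : F ≃ₐ[K] F => Point.map (W' := W.toAffine) (σ : F →ₐ[K] F) P)
      (sqClass (algebraMap K F r))
      fun σ _ => W.twoDescentComponent_map_of_eq_sqClass_algebraMap e₁ e₂ e₃ _ P hr h₁
    rw [hP, twoDescentComponent_zero, if_neg hodd'] at key
    rw [h₁, ← key]
  · have key := twoDescentComponent_sum_of_forall_eq he.swap₁₂ Finset.univ
      (fun σ : F ≃ₐ[K] F => Point.map (W' := W.toAffine) (σ : F →ₐ[K] F) P)
      (sqClass (algebraMap K F s))
      fun σ _ => W.twoDescentComponent_map_of_eq_sqClass_algebraMap e₂ e₁ e₃ _ P hs h₂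
    rw [hP, twoDescentComponent_zero, if_neg hodd'] at key
    rw [h₂, ← key]

omit [W.IsElliptic] in
/-- **A rational `2`-torsion point is not in the norm kernel** of an odd-degree extension: if
`P = (e₁, y) ∈ E(F)` with `e₁ ∈ K` a root of the `2`-division cubic, then `σP = P` for all
`σ ∈ Gal(F/K)` (`y = -(a₁e₁ + a₃)/2` is forced, `eq_twoTorsionY_of_eq`), `2P = O`, and
`∑_σ σP = [F:K]·P = P ≠ O` as `[F:K]` is odd. [folklore] -/
theorem sum_map_ne_zero_of_X_eq_algebraMap (hodd : Odd (Module.finrank K F)) {e₁ : K}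
    {e₂ e₃ : F} (he : (W.baseChange F).toAffine.SplitTwoTorsion (algebraMap K F e₁) e₂ e₃)
    {x y : F} (hxy : (W.baseChange F).toAffine.Nonsingular x y) (hx : x = algebraMap K F e₁) :
    ∑ σ : F ≃ₐ[K] F, Point.map (W' := W.toAffine) (σ : F →ₐ[K] F) (Point.some x y hxy) ≠ 0 := by
  haveI : FiniteDimensional K F := Module.finite_of_finrank_pos hodd.pos
  subst hx
  set P : (W.baseChange F).toAffine.Point := Point.some _ y hxy with hPdef
  -- `y` is forced, hence fixed by every `σ`
  have hy : y = (W.baseChange F).toAffine.twoTorsionY (algebraMap K F e₁) :=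
    eq_twoTorsionY_of_eq he hxy
  have hσy : ∀ σ : F ≃ₐ[K] F, σ y = y := fun σ => by
    rw [hy, twoTorsionY]
    change σ (-((algebraMap K F W.a₁) * algebraMap K F e₁ + algebraMap K F W.a₃) / 2) = _
    rw [map_div₀, map_neg, map_add, map_mul, AlgEquiv.commutes, AlgEquiv.commutes,
      AlgEquiv.commutes, map_ofNat]
    rfl
  have hσP : ∀ σ : F ≃ₐ[K] F, Point.map (W' := W.toAffine) (σ : F →ₐ[K] F) P = P := fun σ => by
    rw [hPdef, Point.map_some]
    congr 1
    · exact σ.commutes e₁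
    · exact hσy σ
  -- `2P = O`
  have h2P : P + P = 0 := by
    rw [hPdef]
    exact add_of_Y_eq rfl (by rw [hy, negY_twoTorsionY])
  have hP0 : P ≠ 0 := Point.some_ne_zero hxy
  obtain ⟨k, hk⟩ : Odd (Fintype.card (F ≃ₐ[K] F)) := by
    rwa [← Nat.card_eq_fintype_card, IsGalois.card_aut_eq_finrank]
  rw [Finset.sum_congr rfl fun σ _ => hσP σ, Finset.sum_const, Finset.card_univ, hk, add_nsmul,
    mul_nsmul, two_nsmul, h2P, nsmul_zero, zero_add, one_nsmul]
  exact hP0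

/-- **`rank E(F) = rank E(K)` from the triviality of the norm-`1` classes: the diophantine
form.** Let `F/K` be a Galois extension of number fields of odd degree and `E/K` an elliptic
curve with rational `2`-torsion `e₁, e₂, e₃ ∈ K`. Suppose that for every point
`(x, y) ∈ E(F)` with `x ≠ e₁, e₂, e₃` such that BOTH norms `N_{F/K}(x - e₁)` and
`N_{F/K}(x - e₂)` are squares in `K`, the elements `x - e₁` and `x - e₂` are themselves squares
in `F`. Then `rank_ℤ E(F) = rank_ℤ E(K)`. Indeed for `P = (x, y)` in the norm kernel
(`∑_σ σP = O`; the `2`-torsion points are never in it, `sum_map_ne_zero_of_X_eq_algebraMap`)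
one has `1 = δⱼ(∑_σ σP) = ∏_σ δⱼ(σP) = class of ∏_σ σ(x - eⱼ) = class of N_{F/K}(x - eⱼ)`
(`twoDescentComponent_sum`, `sqClass_prod`, `Algebra.norm_eq_prod_automorphisms`), so
`N_{F/K}(x - eⱼ)` is a square in `F`, hence in `K` (odd degree,
`isSquare_of_isSquare_algebraMap_of_odd_finrank`); the hypothesis then gives `δ(P) = (1, 1)` and
`mordellWeilRank_baseChange_eq_of_odd_of_twoDescent_normKer` applies. This is the exact shape
of what a `2`-descent "over a minimal non-trivial subfield" of odd prime degree has to deliver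
beyond the descent over `K` (Dokchitser–Dokchitser 2011, proof of Thm. 2): the Selmer classes
over `F` of norm `1` coming from points are trivial. A deliberate dot-notation extension of
Mathlib's `WeierstrassCurve` namespace. [folklore] -/
theorem mordellWeilRank_baseChange_eq_of_odd_of_twoDescent_norm
    (hodd : Odd (Module.finrank K F)) (e₁ e₂ e₃ : K)
    (he : (W.baseChange F).toAffine.SplitTwoTorsion (algebraMap K F e₁) (algebraMap K F e₂)
      (algebraMap K F e₃))
    (hnorm : ∀ x y : F, (W.baseChange F).toAffine.Nonsingular x y →
      x ≠ algebraMap K F e₁ → x ≠ algebraMap K F e₂ → x ≠ algebraMap K F e₃ →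
      IsSquare (Algebra.norm K (x - algebraMap K F e₁)) →
      IsSquare (Algebra.norm K (x - algebraMap K F e₂)) →
      IsSquare (x - algebraMap K F e₁) ∧ IsSquare (x - algebraMap K F e₂)) :
    (W.baseChange F).mordellWeilRank = (W.baseChange K).mordellWeilRank := by
  haveI : (W.baseChange F).IsElliptic := inferInstanceAs (W.map (algebraMap K F)).IsElliptic
  haveI : FiniteDimensional K F := Module.finite_of_finrank_pos hodd.pos
  refine W.mordellWeilRank_baseChange_eq_of_odd_of_twoDescent_normKer F hodd he fun P hP => ?_
  rcases P with _ | ⟨x, y, hxy⟩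
  · exact ⟨rfl, rfl⟩
  · -- `x` is not a `2`-torsion abscissa
    have hx₁ : x ≠ algebraMap K F e₁ := fun hx =>
      W.sum_map_ne_zero_of_X_eq_algebraMap F hodd he hxy hx hP
    have hx₂ : x ≠ algebraMap K F e₂ := fun hx =>
      W.sum_map_ne_zero_of_X_eq_algebraMap F hodd he.swap₁₂ hxy hx hP
    have hx₃ : x ≠ algebraMap K F e₃ := fun hx =>
      W.sum_map_ne_zero_of_X_eq_algebraMap F hodd he.swap₂₃.swap₁₂ hxy hx hP
    -- the norms of `x - e₁`, `x - e₂` are squares in `F`, hence in `K`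
    have hsq : ∀ {a b c : K}, (W.baseChange F).toAffine.SplitTwoTorsion (algebraMap K F a)
        (algebraMap K F b) (algebraMap K F c) → x ≠ algebraMap K F a →
        IsSquare (Algebra.norm K (x - algebraMap K F a)) := by
      intro a b c habc hxa
      have hne : ∀ σ : F ≃ₐ[K] F, (σ : F →ₐ[K] F) x ≠ algebraMap K F a := fun σ h0 =>
        hxa (σ.injective (h0.trans (σ.commutes a).symm))
      have hne' : ∀ σ : F ≃ₐ[K] F, σ (x - algebraMap K F a) ≠ 0 := fun σ => by
        rw [map_sub, AlgEquiv.commutes]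
        exact sub_ne_zero.mpr (hne σ)
      -- `∏_σ δ_a(σP) = class of N(x - a)`
      have hprod : ∏ σ : F ≃ₐ[K] F, twoDescentComponent (W.baseChange F).toAffine
          (algebraMap K F a) (algebraMap K F b) (algebraMap K F c)
            (Point.map (W' := W.toAffine) (σ : F →ₐ[K] F) (Point.some x y hxy)) =
          sqClass (algebraMap K F (Algebra.norm K (x - algebraMap K F a))) := by
        rw [Algebra.norm_eq_prod_automorphisms, sqClass_prod _ _ fun σ _ => hne' σ]
        refine Finset.prod_congr rfl fun σ _ => ?_
        rw [Point.map_some, twoDescentComponent_some_of_ne _ (hne σ), map_sub, AlgEquiv.commutes]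
        rfl
      have key := twoDescentComponent_sum habc Finset.univ
        (fun σ : F ≃ₐ[K] F => Point.map (W' := W.toAffine) (σ : F →ₐ[K] F) (Point.some x y hxy))
      rw [hP, twoDescentComponent_zero, hprod] at key
      have h0 : algebraMap K F (Algebra.norm K (x - algebraMap K F a)) ≠ 0 :=
        (map_ne_zero _).mpr (Algebra.norm_ne_zero_iff.mpr (sub_ne_zero.mpr hxa))
      obtain ⟨w, hw⟩ := (sqClass_eq_one_iff h0).mp key.symm
      exact isSquare_of_isSquare_algebraMap_of_odd_finrank hodd ⟨w, by rw [hw, pow_two]⟩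
    obtain ⟨⟨u, hu⟩, ⟨v, hv⟩⟩ := hnorm x y hxy hx₁ hx₂ hx₃ (hsq he hx₁) (hsq he.swap₁₂ hx₂)
    rw [twoDescentComponent_some_of_ne hxy hx₁, twoDescentComponent_some_of_ne hxy hx₂,
      sqClass_eq_one_iff (sub_ne_zero.mpr hx₁), sqClass_eq_one_iff (sub_ne_zero.mpr hx₂)]
    exact ⟨⟨u, by rw [hu, pow_two]⟩, ⟨v, by rw [hv, pow_two]⟩⟩

end WeierstrassCurve

end
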